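import Summits.Parity.GeneralizedHardyLittlewood.Theses.FordMaynardNoSieveConst0164
import Summits.Parity.GeneralizedHardyLittlewood.Theorems.FordMaynardNoSieveConst0164Assembly
import Summits.Parity.GeneralizedHardyLittlewood.Theorems.FordMaynardNoSieveConst0164NegWitness0164
import Summits.Parity.GeneralizedHardyLittlewood.Theorems.FordMaynardNoSieveConst0164PrimeFreeOfWitnessAtEta
import Summits.Parity.GeneralizedHardyLittlewood.Theorems.FordMaynardNoSieveConst0164NonposOfPrimeFree

/-!
# Route `FordMaynardNoSieveConst0164` — target item `NoSieveConst0164` (stmt-Parity-19101)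

`NoSieveConst0164 := Literature.NumberTheory.Sieve.FordMaynard.NoLowerSieveConstAt (41 / 250)`: no `c > 0` is an
admissible lower-bound linear-sieve constant at `(γ, θ, ν) = (1/2, 0, 41/250)` in the Ford–Maynard framework
(arXiv:2407.14368, Theorem 2.7 (c) moved from the printed `0.1616` to `0.164`; rung F-P1 of Parity, D-0061 —
NOT the summit Statement, zero summit credit).

The route's deciding theorem `closes (hA : Assembly) (h1 : NegWitness0164) (h2 : PrimeFreeOfWitnessAtEta)
(h3 : NonposOfPrimeFree) : NoSieveConst0164` has all four binders landed as theorems: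
`assembly_holds` (stmt-Parity-19105), `negWitness0164_proof` (stmt-Parity-19102, p828112 — the certified negative
Type-I* witness at `(η, γ) = (41/250, 1/2)`), `primeFreeOfWitnessAtEta_holds` (stmt-Parity-19103, Theorem 6.3 (b) at
`P = (γ, 0, η)`), `nonposOfPrimeFree_holds` (stmt-Parity-19104, `IsLowerSieveConst.nonpos_of_primeFreeAdmissible`).
This file is the one-line composition (candidate of record: critic decomp-parity-crit-1 g34, evidence #1 on
stmt-Parity-19101, sha16 b90455574889b85f).  Standard axioms only.
-/

namespace Summit.Parity.GeneralizedHardyLittlewood.Theses.FordMaynardNoSieveConst0164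

/-- **The route target `NoSieveConst0164` (stmt-Parity-19101), by name**: `NoLowerSieveConstAt (41/250)` — every
admissible lower-bound linear-sieve constant `c` at `(γ, θ, ν) = (1/2, 0, 41/250)` satisfies `c ≤ 0`
(Ford–Maynard Theorem 2.7 (c) at `ν₀ = 0.164`), obtained by applying the route's deciding theorem `closes` to the
four landed closers. [cite: FordMaynard2024PrimeSieves, Theorem 2.7 (c) / §8–9] -/
theorem noSieveConst0164_proof :
    Summit.Parity.GeneralizedHardyLittlewood.Theses.FordMaynardNoSieveConst0164.NoSieveConst0164 :=
  closes assembly_holds negWitness0164_proof primeFreeOfWitnessAtEta_holds nonposOfPrimeFree_holds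

end Summit.Parity.GeneralizedHardyLittlewood.Theses.FordMaynardNoSieveConst0164
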